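import Summits.BirchSwinnertonDyer.BirchSwinnertonDyer.Theorems.PrintX11aUpperNonSurjThreeBodyOfContraFacts
import Literature.NumberTheory.EllipticCurves.PAdicLFunctionIntegralityOddMultProofs
import HarnessLib

/-!
# Route `PrintX11a`, crux U3 `UpperNonSurjThree` (item stmt-BirchSwinnertonDyer-20613): Wuthrich 2014 Cor. 18 is a
# THEOREM of the tree at an odd multiplicative prime with `E[p]` irreducible (modulo Mazur 1978 Cor. 4.1), and the
# μ-road re-run without it and without Greenberg 1.5 — the U3 body from TEN print-exact named facts

Cell `bsd-print-x11a`, width seat bsd-line-x11a-p2 g3 (`--supports stmt-BirchSwinnertonDyer-20613 --as helper`). Theorems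
only; Theses-free; BSD is not proved by any of this; nothing is asserted about any curve; item 20613 does not close by this file.

THE POINT. Conjunct 22 of K2's bundle `KatoTwinFactsFiveAn` (item 19949), Wuthrich 2014 Cor. 18
(`Wuthrich2014.corollary18_padicLFunction_mem_iwasawaAlgebra_multiplicative`: the NÉRON-normalised Mazur–Tate–Teitelbaum
function `ϖ·L` lies in `Λ = ℤ_p⟦T⟧` at an odd multiplicative prime, for EVERY `E/ℚ`), is consumed by every μ-road and every
Kato chain of the cell ONLY at pairs where `E[p]` is irreducible (class X11a ∕ X11b). There its conclusion is a THEOREM of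
the tree modulo Mazur's Manin-constant fact (conjunct 9, which the same chains already consume): the coefficients of THE
`Ω⁺_f`-normalised function are limits of Riemann sums of plus symbols `[a/pᵐ]⁺_f`, bounded by `max(1, ‖[0]⁺_f‖_p)` at an odd
`p ∥ N` (tree theorems `norm_coeff_le_max_of_isMultPAdicLFunctionOf_neg_one` ∕ `…_of_isSplitMultPAdicLFunctionOf`, MTT §I.10–I.13
+ the cusp class of `1/p`); `‖[0]⁺_f‖_p ≤ 1` from ONE good Hecke prime `ℓ` with `a_ℓ ≢ ℓ + 1 (mod p)`, which irreducibility
supplies (this lineage's `MultThreeMuAn.norm_ratPlusSymbol_zero_le_one_of_prime`, Darmon–Diamond–Taylor 2.6(b)); and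
`‖ϖ‖_p = 1` is Mazur Cor. 4.1 through `X11b.ClassClosure.norm_ratCast_periodRatio_eq_one_of_mazur`. Hence (§1)
**`X11b.corollary18At_of_irr_of_mazur`**: both clauses of Cor. 18 AT THE PAIR, for every odd multiplicative `p` with
`E[p]` irreducible, every newform and every period ratio — no image hypothesis, no rank hypothesis.

Consequences (all `p`-generic except the `p = 3` instances):
* §2 `MultMu.mu_eq_zero_of_multFineContra_of_mazur` — stepL's print-exact μ-transfer `mu_eq_zero_of_multFineContra`
  (XI′ + Cor. 18 ⟹ one unit coefficient of `ϖ·L` forces `μ(X(E/ℚ_∞)) = 0`) with Cor. 18 REPLACED by Mazur's fact; proof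
  token-for-token, the `Λ`-membership line now reading §1.
* §3 `X11b.multDivisibilityAt_of_katoFacts_of_muAn_contra_of_mazur`, `…_of_muAnZeroAt_contra_of_mazur` — the chain theorems
  of record (stepL p616984) with Cor. 18 replaced by §1 AND Greenberg 1999 Thm. 1.5 (conjunct 21, `Λ`-torsion of `X(E/ℚ_∞)`)
  DROPPED: THE Mazur–Tate–Teitelbaum function exists (tree) and is non-zero as soon as `ϖ·L` has a unit coefficient, and
  bsd-2adic's VII′ `SelmerDualContra.katoDivisibility_{split,nonsplit}Mult_of_contra_facts_conductorLevel` (Kato 12.4 + V′ ∕ VI′)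
  returns `X` torsion together with the `⊗ℚ` divisibility at a non-zero `L`. So `X11b.MultDivisibilityAt W p` at an odd
  multiplicative pair with `E[p]` irreducible and `ρ̄` not onto follows from {(12.2.1) `hne`, Kato 12.4, modularity, V′, VI′,
  XI′, Mazur} and the analytic certificate. These serve U5 (`UpperNonSurjFive`, item 20614) and K2's corner verbatim.
* §4 **`ClassX11a.upperNonSurjThree_body_of_tenFacts`**: the body of U3,
  `∀ W p, ClassX11a W p → ¬Surj W p → p = 3 → Typed.MissingUpperBoundAt W p`, from TEN named facts, all print-exact —
  Stein–Wuthrich 6.1 ×2, GZK, Greenberg–Stevens ∕ Kobayashi, Kato 12.4, modularity, Kato §17.13 V′ ∕ VI′ ∕ XI′, Mazur Cor. 4.1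
  (the per-pair form asks Greenberg–Stevens only at a split `3`); compare FOURTEEN in p616233 and TWELVE in
  `upperNonSurjThree_body_of_contraFacts`. The analytic input stays this lineage's theorem
  `MultThreeMuAn.muAnZeroAt_three_of_mult_of_irr` (Greenberg's analytic `μ₃ = 0` at a multiplicative `3`).
For the planner: in every consumer with `E[p]` irreducible, Cor. 18 (conjunct 22) is REDUNDANT given conjunct 9, and on the
μ-road Greenberg 1.5 (conjunct 21) is REDUNDANT given Kato 12.4 + V′ ∕ VI′; a U3 input item needs exactly the ten conjuncts of §4.
References (locators only): [cite: Wuthrich2014, Cor. 18 (p. 398), Thm. 1 (p. 381)] [cite: Mazur1978, Cor. 4.1]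
[cite: MazurTateTeitelbaum1986Invent, §I.10, §I.12–I.13] [cite: DarmonDiamondTaylor1995, Prop. 2.6(b)]
[cite: Kato2004Asterisque, Thm. 12.4 (p. 221), §17.13 (pp. 279–280)] [cite: SteinWuthrich2013, Thm. 6.1 (p. 20)]
[cite: GreenbergLNM1716, §1 Conj. 1.11 (p. 58), Thm. 1.5 (p. 61)] [cite: GreenbergVatsal2000, Prop. 3.7].
-/

set_option autoImplicit false

noncomputable section

open scoped Classical MatrixGroups ModularForm NumberField

open CongruenceSubgroup WeierstrassCurve Field IsDedekindDomain
open Literature.NumberTheory.GaloisRepresentations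
open Literature.NumberTheory.GaloisCohomology
open Literature.NumberTheory.EllipticCurves Literature.NumberTheory.EllipticCurves.ModularForms
open Literature.NumberTheory.EllipticCurves.Kato2004 Literature.NumberTheory.EllipticCurves.Kato2004.EulerSystemValues
open Literature.NumberTheory.EllipticCurves.Rank1Residual Literature.NumberTheory.EllipticCurves.Rank1Residual.Typed
open Literature.NumberTheory.EllipticCurves.Wuthrich2014 Literature.NumberTheory.EllipticCurves.Greenberg1999
open Literature.NumberTheory.EllipticCurves.SteinWuthrich2013
open Summit.BirchSwinnertonDyer.BirchSwinnertonDyer.Rank1Residual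
open Summit.BirchSwinnertonDyer.BirchSwinnertonDyer.Theorems

/-! ### §1 Wuthrich Cor. 18 AT THE PAIR from irreducibility and Mazur's fact -/

namespace Summit.BirchSwinnertonDyer.Rank1Residual.X11b

/-- **Wuthrich 2014 Cor. 18 at an odd multiplicative prime with `E[p]` irreducible is a theorem of the tree modulo Mazur
1978 Cor. 4.1.** For `W/ℚ` globally minimal, `p ≠ 2` a prime of multiplicative reduction with `E[p]` irreducible, ANY
newform `f` of `W` and ANY `ϖ ∈ ℚ` with `ϖ·Ω_E = Ω⁺_f`: THE `Ω⁺_f`-normalised Mazur–Tate–Teitelbaum function `L`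
(`IsMultPAdicLFunctionOf f p (−1) L` non-split, `IsSplitMultPAdicLFunctionOf f p L` split) satisfies `ϖ·L = ι G` for some
`G ∈ Λ = ℤ_p⟦T⟧` — literally the two clauses of `corollary18_padicLFunction_mem_iwasawaAlgebra_multiplicative` at
`(W, p, f, ϖ)`. Proof: `‖[Tᵏ]L‖_p ≤ max(1, ‖[0]⁺_f‖_p)` (Riemann sums, tree), `‖[0]⁺_f‖_p ≤ 1` from a good Hecke prime
`ℓ` with `a_ℓ ≢ ℓ + 1 (mod p)` (irreducibility), `‖ϖ‖_p = 1` (Mazur), and `Λ ↪ ℚ_p⟦T⟧` coefficientwise.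
[cite: Wuthrich2014, Cor. 18 (p. 398)] [cite: MazurTateTeitelbaum1986Invent, §I.10, §I.12–I.13] [cite: Mazur1978, Cor. 4.1]
[cite: DarmonDiamondTaylor1995, Prop. 2.6(b)] -/
theorem corollary18At_of_irr_of_mazur (hMz : mazur_not_dvd_maninConstant_of_odd)
    (W : WeierstrassCurve ℚ) [W.IsElliptic] [W.IsGloballyMinimal] (p : ℕ) [Fact p.Prime]
    {N : ℕ} [NeZero N] {f : CuspForm (Gamma0 N) 2}
    (hp2 : p ≠ 2) (hmult : W.HasMultiplicativeReductionAtPrime p) (hirr : W.HasIrreducibleModPGaloisRep p)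
    (hf : IsNewformOf W f) (ϖ : ℚ) (hϖ : (ϖ : ℝ) * W.realPeriodRat = plusPeriod f) :
    (¬ W.HasSplitMultiplicativeReductionAtPrime p →
        ∀ L : PowerSeries ℚ_[p], IsMultPAdicLFunctionOf f p (-1) L →
          ∃ G : IwasawaAlgebra p, iwasawaToPowerSeries p G = PowerSeries.C ((ϖ : ℚ) : ℚ_[p]) * L) ∧
      (W.HasSplitMultiplicativeReductionAtPrime p →
        ∀ L : PowerSeries ℚ_[p], IsSplitMultPAdicLFunctionOf f p L →
          ∃ G : IwasawaAlgebra p, iwasawaToPowerSeries p G = PowerSeries.C ((ϖ : ℚ) : ℚ_[p]) * L) := by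
  have hQ : coeffField f = ⊥ := hf.coeffField_eq_bot
  -- `‖ϖ‖ = 1` (Mazur) and `‖[0]⁺_f‖ ≤ 1` (a good Hecke prime from irreducibility)
  have hϖ1 : ‖((ϖ : ℚ) : ℚ_[p])‖ = 1 :=
    X11b.ClassClosure.norm_ratCast_periodRatio_eq_one_of_mazur W p hMz hp2 hmult hirr hf hϖ
  obtain ⟨ℓ, hℓinst, -, hgoodℓ, hℓ1⟩ :=
    exists_prime_not_dvd_frobeniusTrace_sub not_irreducible_of_frobeniusTrace_congr_holds W p hirr
  haveI := hℓinst
  have h0 : ‖((ratPlusSymbol f 0 : ℚ) : ℚ_[p])‖ ≤ 1 :=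
    MultThreeMuAn.norm_ratPlusSymbol_zero_le_one_of_prime hf.1 hQ hp2 (not_dvd_level_of_isNewformOf hf hgoodℓ)
      (cuspCoeff_eq_frobeniusTrace_of_isNewformOf_holds hf hgoodℓ) hℓ1
  have hmax : max 1 ‖((ratPlusSymbol f 0 : ℚ) : ℚ_[p])‖ = 1 := max_eq_left h0
  -- `Λ ↪ ℚ_p⟦T⟧` coefficientwise
  have key : ∀ L : PowerSeries ℚ_[p], (∀ k : ℕ, ‖PowerSeries.coeff k L‖ ≤ 1) →
      ∃ G : IwasawaAlgebra p, iwasawaToPowerSeries p G = PowerSeries.C ((ϖ : ℚ) : ℚ_[p]) * L := by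
    intro L hL
    refine (exists_iwasawaToPowerSeries_eq_iff_norm_coeff_le_one _).mpr fun k ↦ ?_
    rw [PowerSeries.coeff_C_mul, norm_mul, hϖ1, one_mul]
    exact hL k
  refine ⟨fun hns L hL ↦ key L fun k ↦ ?_, fun hs L hL ↦ key L fun k ↦ ?_⟩
  · exact (norm_coeff_le_max_of_isMultPAdicLFunctionOf_neg_one hf hp2 hmult hns hL k).trans hmax.le
  · exact (norm_coeff_le_max_of_isSplitMultPAdicLFunctionOf hf hp2 hs hL k).trans hmax.le

end Summit.BirchSwinnertonDyer.Rank1Residual.X11b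

/-! ### §2 The print-exact `μ`-transfer without Cor. 18 -/

namespace Summit.BirchSwinnertonDyer.Rank1Residual.X11b.MultMu

open Module

/-- **KATO `μ`-TRANSFER AT A MULTIPLICATIVE ODD PRIME, NO BIG IMAGE, from XI′ and Mazur's fact** — the statement of stepL's
`mu_eq_zero_of_multFineContra` VERBATIM (for a globally minimal `W/ℚ`, an ODD multiplicative `p` with `E[p]` irreducible and
`ρ̄_{E,p}` NOT onto, a newform `f`, period ratio `ϖ`, the Mazur–Tate–Teitelbaum function `L` with `α = a_p = ±1`: ONE `p`-adic
unit coefficient of `ϖ·L` forces `μ(X(E/ℚ_∞)) = 0` for EVERY cyclotomic γ-keyed Selmer dual datum `D`), with the input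
Wuthrich Cor. 18 REPLACED by Mazur 1978 Cor. 4.1: the `Λ`-membership `ϖ·L = ι G₁` is §1 (`corollary18At_of_irr_of_mazur`,
`E[p]` irreducible is a hypothesis of the statement). The rest of the proof is stepL's, token for token (twist to the
contragredient structure, XI′, §6 (i), the reduction-free γ-keyed core, `length_(p)` bookkeeping at the ι-fixed prime `(p)`).
CONDITIONAL on XI′ and Mazur's fact; nothing booked. [cite: Kato2004Asterisque, Thm. 12.6 (p. 222), (14.9.3) (p. 240), §17.13 (pp. 279–280)]
[cite: Mazur1978, Cor. 4.1] [cite: Greenberg1989, §0 pp. 101–102] [cite: Washington1997, §13.2] -/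
theorem mu_eq_zero_of_multFineContra_of_mazur (hfine' : exists_multDivisibilityInputs_fine_contra)
    (hMz : mazur_not_dvd_maninConstant_of_odd) :
    ∀ (W : WeierstrassCurve ℚ) [W.IsElliptic] [W.IsGloballyMinimal] (p : ℕ) [Fact p.Prime]
      {N : ℕ} [NeZero N] (f : CuspForm (Gamma0 N) 2),
      p ≠ 2 → W.HasMultiplicativeReductionAtPrime p →
      W.HasIrreducibleModPGaloisRep p → ¬ W.HasSurjectiveModNGaloisRep p → IsNewformOf W f →
      ∀ (ϖ : ℚ), (ϖ : ℝ) * W.realPeriodRat = plusPeriod f →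
      ∀ (a : ℚ_[p]) (L : PowerSeries ℚ_[p]),
        (W.HasSplitMultiplicativeReductionAtPrime p → a = 1) →
        (¬ W.HasSplitMultiplicativeReductionAtPrime p → a = -1) →
        IsMultPAdicLFunctionOf f p a L →
        (∃ n : ℕ, ‖PowerSeries.coeff n (PowerSeries.C ((ϖ : ℚ) : ℚ_[p]) * L)‖ = 1) →
      ∀ (κ : ZpExtension ℚ p) (γ : absoluteGaloisGroup ℚ),
        κ.IsCyclotomic → κ.IsTopGenerator γ → IsCyclotomicVariable p γ →
        ∀ D : W.SelmerDualData κ γ, D.mu = 0 := by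
  intro W _ _ p _ N _ f hp2 hmult hirr hnsurj hf ϖ hϖ a L hsa hna hL hcert κ γ hκ hγ hγ' D
  haveI : ContinuousSMul ℤ_[p] (W.tateModule p) := TateModule.continuousSMul_padicInt
  haveI : Module.Free ℤ_[p] (W.tateModule p) := W.module_free_tateModule_holds p
  haveI : Module.Finite ℤ_[p] (W.tateModule p) := W.module_finite_tateModule_holds p
  -- the pinned modules: `𝐇¹_Γ(T_pW)` (γ-keyed) and a dual fine Selmer datum (γ-keyed)
  obtain ⟨I⟩ := nonempty_iwasawaH1Data_holds W p κ γ hκ hγ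
  obtain ⟨Y⟩ := W.nonempty_fineSelmerDualData κ hγ
  haveI : Module.Finite (IwasawaAlgebra p) D.X :=
    WeierstrassCurve.SelmerDualData.module_finite_of_isCyclotomic W κ hκ D hγ
  -- TWIST both duals to the CONTRAGREDIENT `Λ`-structure (`T ↦ (1+T)⁻¹ − 1`, i.e. `γ ↦ γ⁻¹`)
  obtain ⟨D', eD, heD, -, -, -, hlenD, hfinD⟩ :=
    SignedKatoOffTwo.IwasawaInvolution.exists_twist_selmerDualData_invol_of_mul_inv D
  obtain ⟨Y', eY, heY, -, -, -, -⟩ :=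
    SignedKatoOffTwo.IwasawaInvolution.exists_twist_fineSelmerDualData_invol (mul_inv_cancel γ) Y
  haveI : Module.Finite (IwasawaAlgebra p) D'.X := hfinD.mp inferInstance
  -- Kato's PRINT-EXACT package at the multiplicative prime for `(𝐇¹_γ, D′, Y′)`, with fine quotient, span and image clauses
  obtain ⟨K, π, hloc0, hπs, hπ, hZ, himg⟩ := hfine' W p f κ γ hp2 hmult hκ hγ hγ' hf a L hsa hna hL I D' Y'
  haveI : Module.Finite (IwasawaAlgebra p) Y'.X := Module.Finite.of_surjective π hπs
  -- `ϖ·L ∈ Λ` — §1 (irreducibility + Mazur) in place of Wuthrich 2014 Cor. 18 — and the certificate: `G₁ ∉ (p)`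
  obtain ⟨G₁, hG₁⟩ : ∃ G₁ : IwasawaAlgebra p,
      iwasawaToPowerSeries p G₁ = PowerSeries.C ((ϖ : ℚ) : ℚ_[p]) * L := by
    obtain ⟨hns, hs⟩ := corollary18At_of_irr_of_mazur hMz W p hp2 hmult hirr hf ϖ hϖ
    by_cases hsplit : W.HasSplitMultiplicativeReductionAtPrime p
    · have ha : a = 1 := hsa hsplit
      subst ha
      exact hs hsplit L ((isMultPAdicLFunctionOf_one_iff L).mp hL)
    · have ha : a = -1 := hna hsplit
      subst ha
      exact hns hsplit L hL
  have hμL : G₁ ∉ IwasawaAlgebra.augIdealP p := not_mem_augIdealP_of_norm_coeff_eq_one hG₁ hcert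
  let 𝔭 : PrimeSpectrum (IwasawaAlgebra p) :=
    ⟨IwasawaAlgebra.augIdealP p, IwasawaAlgebra.isPrime_augIdealP_holds p⟩
  have himg𝔭 : ∃ s : IwasawaAlgebra p, s ∉ IwasawaAlgebra.augIdealP p ∧
      s * G₁ ∈ Submodule.map (K.col ∘ₗ K.loc) K.Z := by
    obtain ⟨s, hs, hsG, -⟩ :=
      himg hirr G₁ ϖ hϖ hG₁ 𝔭 (by exact IwasawaAlgebra.height_augIdealP_holds p)
    exact ⟨s, hs, hsG⟩
  -- §6 (i): some GENUINE Euler-system class is not divisible by `p`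
  obtain ⟨s, hs, hsp⟩ := exists_isEulerSystemClass_not_mem_of_multContra K hZ hμL himg𝔭
  -- the reduction-free γ-keyed core: a power of `T = γ − 1` kills the `E[p]`-lifts of `Sel₀`
  obtain ⟨J, hJ⟩ := CoreAssembly.coreOdd_anyReduction_holds W p κ γ I hp2 hirr
    (by exact_mod_cast hnsurj) hκ hγ ⟨s, hs, hsp⟩
  -- `Sel₀[p]` finite ⟹ `Y′.X/(p)` finite — key-free
  haveI : Finite (Y'.X ⧸ (IwasawaAlgebra.augIdealP p • (⊤ : Submodule (IwasawaAlgebra p) Y'.X))) :=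
    Y'.finite_quotient_augIdealP_of_finite_pTorsion
      (W.finite_fineSelmerInfty_pTorsion_of_forall_iterate_eq_zero κ hγ hJ)
  -- bookkeeping at `𝔭 = (p)`: `length Y′_𝔭 = 0 ⟹ length D′_𝔭 = 0`
  have hY0 : Module.lengthAt (IwasawaAlgebra p) Y'.X 𝔭 = 0 :=
    Summit.BirchSwinnertonDyer.BirchSwinnertonDyer.Rank1Residual.KatoMuSkeleton.lengthAt_eq_zero_of_finite_quotient_p
      (M := Y'.X) 𝔭 rfl
  have hX0' : Module.lengthAt (IwasawaAlgebra p) D'.X 𝔭 = 0 :=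
    le_antisymm ((lengthAt_X_le_of_multContra K hloc0 𝔭 hμL himg𝔭 π hπ).trans hY0.le) bot_le
  -- back to the γ-datum: `(p)` is a fixed point of `ι` on `Spec Λ`
  have hX0 : Module.lengthAt (IwasawaAlgebra p) D.X 𝔭 = 0 := by
    rw [← IwasawaAlgebra.comap_invol_eq_self_of_asIdeal_eq_augIdealP p 𝔭 rfl, hlenD 𝔭]
    exact hX0'
  change muInvariant p D.X = 0
  rw [muInvariant_eq_toNat_lengthAt p D.X 𝔭 rfl, hX0]
  rfl

end Summit.BirchSwinnertonDyer.Rank1Residual.X11b.MultMu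

/-! ### §3 The chain theorems of record without Cor. 18 and without Greenberg 1.5 (conclusion `X11b.MultDivisibilityAt W p`) -/

namespace Summit.BirchSwinnertonDyer.Rank1Residual.X11b

/-- **`X11b.MultDivisibilityAt W p` from the analytic certificate, on the contragredient packages, WITHOUT Wuthrich Cor. 18
and WITHOUT Greenberg 1999 Thm. 1.5** — stepL's `multDivisibilityAt_of_katoFacts_of_muAn_contra` (p616984) with `h18 ↦ hMz`
(§1) and `h15` DROPPED: for `W` globally minimal, `p` an ODD multiplicative prime with `E[p]` irreducible and `ρ̄_{E,p}` NOT
onto, the unit-coefficient certificate `hAn` at every newform ∕ period ratio ∕ MTT function gives the typed divisibility.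
`Λ`-torsion of `X(E/ℚ_∞)`: THE Mazur–Tate–Teitelbaum function of the reduction sign's kind EXISTS (tree:
`exists_isSplitMultPAdicLFunctionOf`, `exists_isMultPAdicLFunctionOf_neg_one_of_nonsplit`) and is NON-ZERO because `ϖ·L` has
a unit coefficient (`hAn`), so bsd-2adic's VII′ `SelmerDualContra.katoDivisibility_{split,nonsplit}Mult_of_contra_facts_conductorLevel`
(Kato 12.4 + V′ ∕ VI′ at the conductor level, `IsNewformOf.level_eq_conductorNorm_of_exists_isNewformOf`) returns
`D.IsTorsion` together with the `⊗ℚ` divisibility; `μ = 0` by §2; integrality by §1; membership by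
`mem_charIdeal_of_katoRat_of_integral_of_mu_eq_zero` ∕ `…_split`. CONDITIONAL on the named facts {(12.2.1) `hne`, Kato 12.4,
modularity, V′, VI′, XI′, Mazur}; nothing booked. [cite: Kato2004Asterisque, Thm. 12.4 (p. 221), Thm. 12.6 (p. 222), Thm. 17.4 (1) (p. 273; shape), §17.13 (pp. 279–280)]
[cite: Mazur1978, Cor. 4.1] [cite: MazurTateTeitelbaum1986Invent, §I.10, §I.14] -/
theorem multDivisibilityAt_of_katoFacts_of_muAn_contra_of_mazur
    (hne : nonempty_iwasawaH1Data) (h12 : thm12_4) (hnf : exists_isNewformOf)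
    (hns' : exists_multDivisibilityInputs_nonsplit_contra)
    (hsp' : exists_multDivisibilityInputs_split_contra)
    (hfine' : exists_multDivisibilityInputs_fine_contra) (hMz : mazur_not_dvd_maninConstant_of_odd)
    (W : WeierstrassCurve ℚ) [W.IsElliptic] [W.IsGloballyMinimal] (p : ℕ) [Fact p.Prime]
    (hp : p ≠ 2) (hmult : Mult W p) (hirr : Irr W p) (hnsurj : ¬ Surj W p)
    (hAn : ∀ {N : ℕ} [NeZero N] (f : CuspForm (Gamma0 N) 2), IsNewformOf W f →
      ∀ (ϖ : ℚ), (ϖ : ℝ) * W.realPeriodRat = plusPeriod f →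
      ∀ (a : ℚ_[p]) (L : PowerSeries ℚ_[p]),
        (W.HasSplitMultiplicativeReductionAtPrime p → a = 1) →
        (¬ W.HasSplitMultiplicativeReductionAtPrime p → a = -1) →
        IsMultPAdicLFunctionOf f p a L →
        ∃ n : ℕ, ‖PowerSeries.coeff n (PowerSeries.C ((ϖ : ℚ) : ℚ_[p]) * L)‖ = 1) :
    MultDivisibilityAt W p := by
  haveI : ContinuousSMul ℤ_[p] (W.tateModule p) := TateModule.continuousSMul_padicInt
  intro κ γ N _ f hκ hγ hγ' hf D ϖ _hϖ0 hϖ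
  have hN : N = W.conductorNorm ℤ := IsNewformOf.level_eq_conductorNorm_of_exists_isNewformOf hnf hf
  subst hN
  obtain ⟨hint_ns, hint_s⟩ := corollary18At_of_irr_of_mazur hMz W p hp hmult hirr hf ϖ hϖ
  -- a unit coefficient of `ϖ·L` makes `L ≠ 0`
  have hne0 : ∀ L : PowerSeries ℚ_[p],
      (∃ n : ℕ, ‖PowerSeries.coeff n (PowerSeries.C ((ϖ : ℚ) : ℚ_[p]) * L)‖ = 1) → L ≠ 0 := by
    rintro L ⟨n, hn⟩ rfl
    simp at hn
  -- `μ(X) = 0` from the certificate (§2)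
  have hμ : ∀ (a : ℚ_[p]) (L : PowerSeries ℚ_[p]), (W.HasSplitMultiplicativeReductionAtPrime p → a = 1) →
      (¬ W.HasSplitMultiplicativeReductionAtPrime p → a = -1) → IsMultPAdicLFunctionOf f p a L → D.mu = 0 :=
    fun a L hsa hna hL ↦
      MultMu.mu_eq_zero_of_multFineContra_of_mazur hfine' hMz W p f hp hmult hirr hnsurj hf ϖ hϖ a L hsa hna hL
        (hAn f hf ϖ hϖ a L hsa hna hL) κ γ hκ hγ hγ' D
  by_cases hsplit : W.HasSplitMultiplicativeReductionAtPrime p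
  · have h1 : ∀ L : PowerSeries ℚ_[p], IsSplitMultPAdicLFunctionOf f p L → L ≠ 0 := fun L hL ↦
      hne0 L (hAn f hf ϖ hϖ 1 L (fun _ => rfl) (fun hns'' => absurd hsplit hns'')
        ((isMultPAdicLFunctionOf_one_iff L).mpr hL))
    refine ⟨?_, fun hn => absurd hsplit hn, fun _ L hL => ?_⟩
    · obtain ⟨L, hL⟩ := exists_isSplitMultPAdicLFunctionOf hsplit hf
      exact (SelmerDualContra.katoDivisibility_splitMult_of_contra_facts_conductorLevel hne h12 hsp' hp hsplit hκ hγ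
        hγ' hf hL (h1 L hL) D).1
    · obtain ⟨hX, n, g, hg, hι⟩ := SelmerDualContra.katoDivisibility_splitMult_of_contra_facts_conductorLevel hne h12
        hsp' hp hsplit hκ hγ hγ' hf hL (h1 L hL) D
      have hμD : D.mu = 0 :=
        hμ 1 L (fun _ => rfl) (fun hns'' => absurd hsplit hns'') ((isMultPAdicLFunctionOf_one_iff L).mpr hL)
      obtain ⟨G, hG⟩ := hint_s hsplit L hL
      exact exists_mem_charIdeal_of_katoRat_of_integral_of_mu_eq_zero_split hγ D hX hμD hg hι hG
  · have h1 : ∀ L : PowerSeries ℚ_[p], IsMultPAdicLFunctionOf f p (-1) L → L ≠ 0 := fun L hL ↦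
      hne0 L (hAn f hf ϖ hϖ (-1) L (fun hs => absurd hs hsplit) (fun _ => rfl) hL)
    refine ⟨?_, fun _ L hL => ?_, fun hs => absurd hs hsplit⟩
    · obtain ⟨L, hL⟩ := exists_isMultPAdicLFunctionOf_neg_one_of_nonsplit hf hmult hsplit
      exact (SelmerDualContra.katoDivisibility_nonsplitMult_of_contra_facts_conductorLevel hne h12 hns' hp hmult hsplit
        hκ hγ hγ' hf hL (h1 L hL) D).1
    · obtain ⟨hX, n, g, hg, hι⟩ := SelmerDualContra.katoDivisibility_nonsplitMult_of_contra_facts_conductorLevel hne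
        h12 hns' hp hmult hsplit hκ hγ hγ' hf hL (h1 L hL) D
      have hμD : D.mu = 0 := hμ (-1) L (fun hs => absurd hs hsplit) (fun _ => rfl) hL
      obtain ⟨G, hG⟩ := hint_ns hsplit L hL
      exact ⟨G, mem_charIdeal_of_katoRat_of_integral_of_mu_eq_zero hγ D hX hμD hg hι hG, hG⟩

/-- **`X11a.MuAnZeroAt W p ⟹ X11b.MultDivisibilityAt W p` at an odd multiplicative pair with `E[p]` irreducible and `ρ̄` NOT
onto, on the contragredient packages, WITHOUT Cor. 18 and WITHOUT Greenberg 1.5** — `multDivisibilityAt_of_katoFacts_of_muAnZeroAt_contra`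
with `h18 ↦ hMz` and `h15` dropped: unpack the lane certificate into the `a = ±1` form and apply the previous theorem. Serves the
μ-roads of U3 (`p = 3`, below), U5 (item 20614, `p ∈ {5,7}`) and K2's corner with two named facts fewer. CONDITIONAL; nothing
booked. [cite: Kato2004Asterisque, Thm. 12.4 (p. 221) and §17.13 (pp. 279–280)] [cite: Mazur1978, Cor. 4.1] -/
theorem multDivisibilityAt_of_katoFacts_of_muAnZeroAt_contra_of_mazur
    (hne : nonempty_iwasawaH1Data) (h12 : thm12_4) (hnf : exists_isNewformOf)
    (hns' : exists_multDivisibilityInputs_nonsplit_contra)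
    (hsp' : exists_multDivisibilityInputs_split_contra)
    (hfine' : exists_multDivisibilityInputs_fine_contra) (hMz : mazur_not_dvd_maninConstant_of_odd)
    (W : WeierstrassCurve ℚ) [W.IsElliptic] [W.IsGloballyMinimal] (p : ℕ) [Fact p.Prime]
    (hp : p ≠ 2) (hmult : Mult W p) (hirr : Irr W p) (hnsurj : ¬ Surj W p) (hA : X11a.MuAnZeroAt W p) :
    MultDivisibilityAt W p :=
  multDivisibilityAt_of_katoFacts_of_muAn_contra_of_mazur hne h12 hnf hns' hsp' hfine' hMz W p hp hmult hirr hnsurj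
    (fun f hf ϖ hϖ a L hsa hna hL => by
      obtain ⟨hAns, hAs⟩ := hA f hf ϖ hϖ
      by_cases hsplit : W.HasSplitMultiplicativeReductionAtPrime p
      · have ha : a = 1 := hsa hsplit
        subst ha
        exact hAs hsplit L ((isMultPAdicLFunctionOf_one_iff L).mp hL)
      · have ha : a = -1 := hna hsplit
        subst ha
        exact hAns hsplit L hL)

/-- **`X11b.MultDivisibilityAt W 3` at a multiplicative `3` with `E[3]` irreducible and `ρ̄_{E,3}` NOT onto, from SIX named
facts** (Kato 12.4, modularity, V′ ∕ VI′ ∕ XI′, Mazur Cor. 4.1): the previous theorem with `𝐇¹_Γ(T_pW)` from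
`Kato2004.nonempty_iwasawaH1Data_holds` and the analytic certificate from `MultThreeMuAn.muAnZeroAt_three_of_mult_of_irr`.
CONDITIONAL; nothing booked. [cite: Kato2004Asterisque, Thm. 12.4 (p. 221), §17.13 (pp. 279–280)] [cite: Mazur1978, Cor. 4.1]
[cite: GreenbergLNM1716, §1 Conj. 1.11 (p. 58)] -/
theorem multDivisibilityAt_three_of_not_surj_of_sixFacts
    (h12 : thm12_4) (hnf : exists_isNewformOf)
    (hns' : exists_multDivisibilityInputs_nonsplit_contra) (hsp' : exists_multDivisibilityInputs_split_contra)
    (hfine' : exists_multDivisibilityInputs_fine_contra) (hMz : mazur_not_dvd_maninConstant_of_odd)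
    (W : WeierstrassCurve ℚ) [W.IsElliptic] [W.IsGloballyMinimal]
    (hmult : Mult W 3) (hirr : Irr W 3) (hnsurj : ¬ Surj W 3) : MultDivisibilityAt W 3 :=
  haveI : Fact (Nat.Prime 3) := ⟨Nat.prime_three⟩
  multDivisibilityAt_of_katoFacts_of_muAnZeroAt_contra_of_mazur nonempty_iwasawaH1Data_holds h12 hnf hns' hsp' hfine' hMz
    W 3 (by decide) hmult hirr hnsurj (MultThreeMuAn.muAnZeroAt_three_of_mult_of_irr hMz W hmult hirr)

end Summit.BirchSwinnertonDyer.Rank1Residual.X11b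

/-! ### §4 The body of U3 from ten print-exact named facts -/

namespace Summit.BirchSwinnertonDyer.Rank1Residual.ClassX11a

/-- **Per pair, ten facts minus Greenberg–Stevens at a non-split `3`.** At an X11a pair `(W, 3)` (`r_an = 0`, `3 ∥ N`, `E[3]`
irreducible) with `ρ̄_{E,3}` not surjective: `ord₃ #Ш ≤ ord₃ #Ш_an` (`Typed.MissingUpperBoundAt W 3`), modulo NINE named facts
plus — only when the reduction at `3` is split — the exceptional-zero formula at the pair. §3 then the sharpened K2 engine
`X11b.missingUpperBoundAt_of_multDivisibilityAt_of_analyticRank_eq_zero_of_newform`.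
[cite: Kato2004Asterisque, Thm. 12.4 (p. 221), §17.13 (pp. 279–280)] [cite: SteinWuthrich2013, Thm. 6.1 (p. 20)]
[cite: Mazur1978, Cor. 4.1] [cite: GreenbergLNM1716, §1 Conj. 1.11 (p. 58)] -/
theorem missingUpperBoundAt_three_of_not_surj_of_tenFacts
    (hJs : thm61_splitMultiplicative) (hJn : thm61_nonsplitMultiplicative)
    (hGZK : rank_eq_analyticRank_of_analyticRank_le_one) (h12 : Kato2004.thm12_4) (hnf : exists_isNewformOf)
    (hns' : Kato2004.exists_multDivisibilityInputs_nonsplit_contra)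
    (hsp' : Kato2004.exists_multDivisibilityInputs_split_contra)
    (hfine' : Kato2004.exists_multDivisibilityInputs_fine_contra) (hMz : mazur_not_dvd_maninConstant_of_odd)
    (W : WeierstrassCurve ℚ) [W.IsElliptic] [W.IsGloballyMinimal] [Fact (Nat.Prime 3)]
    (hGS : W.HasSplitMultiplicativeReductionAtPrime 3 → greenberg_stevens (W := W) (p := 3))
    (hX : ClassX11a W 3) (hns : ¬ Surj W 3) : Typed.MissingUpperBoundAt W 3 :=
  X11b.missingUpperBoundAt_of_multDivisibilityAt_of_analyticRank_eq_zero_of_newform hJs hJn hGZK hnf W 3 hGS hX.2.1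
    hX.2.2.1 hX.1
    (X11b.multDivisibilityAt_three_of_not_surj_of_sixFacts h12 hnf hns' hsp' hfine' hMz W hX.2.2.1 hX.2.2.2.1 hns)

/-- **The body of U3 from TEN print-exact named facts (μ-road, whole domain, contragredient packages; Cor. 18 and Greenberg
1.5 discharged).** At every X11a pair `(W, 3)` with `ρ̄_{E,3}` not surjective: `ord₃ #Ш ≤ ord₃ #Ш_an`
(`Typed.MissingUpperBoundAt W 3`), modulo Stein–Wuthrich 6.1 ×2 (`hJs`, `hJn`), Gross–Zagier–Kolyvagin (`hGZK`),
Greenberg–Stevens ∕ Kobayashi (`hGS`), Kato 12.4 (`h12`), modularity (`hnf`), Kato §17.13 V′ ∕ VI′ ∕ XI′ (`hns'`, `hsp'`,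
`hfine'`), Mazur Cor. 4.1 (`hMz`) — the analytic `μ₃ = 0` input being the THEOREM `MultThreeMuAn.muAnZeroAt_three_of_mult_of_irr`,
Wuthrich Cor. 18 the THEOREM §1 and `Λ`-torsion read off Kato's theorem at a non-zero `L`. Compare FOURTEEN hypotheses in p616233
and TWELVE in `upperNonSurjThree_body_of_contraFacts`. [cite: Kato2004Asterisque, §17.13 (pp. 279–280)]
[cite: SteinWuthrich2013, Thm. 6.1 (p. 20)] [cite: Mazur1978, Cor. 4.1] [cite: GreenbergLNM1716, §1 Conj. 1.11 (p. 58)]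
[cite: Kobayashi2006DocMath, Cor. 4.2 (p. 575)] -/
theorem upperNonSurjThree_body_of_tenFacts
    (hJs : thm61_splitMultiplicative) (hJn : thm61_nonsplitMultiplicative)
    (hGZK : rank_eq_analyticRank_of_analyticRank_le_one)
    (hGS : ∀ (W : WeierstrassCurve ℚ) [W.IsElliptic] [W.IsGloballyMinimal] (p : ℕ) [Fact p.Prime],
      greenberg_stevens (W := W) (p := p))
    (h12 : Kato2004.thm12_4) (hnf : exists_isNewformOf)
    (hns' : Kato2004.exists_multDivisibilityInputs_nonsplit_contra)
    (hsp' : Kato2004.exists_multDivisibilityInputs_split_contra)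
    (hfine' : Kato2004.exists_multDivisibilityInputs_fine_contra) (hMz : mazur_not_dvd_maninConstant_of_odd) :
    ∀ (W : WeierstrassCurve ℚ) [W.IsElliptic] [W.IsGloballyMinimal] (p : ℕ) [Fact p.Prime],
      ClassX11a W p → ¬ Surj W p → p = 3 → Typed.MissingUpperBoundAt W p := by
  intro W _ _ p _ hX hns hp3
  subst hp3
  exact missingUpperBoundAt_three_of_not_surj_of_tenFacts hJs hJn hGZK h12 hnf hns' hsp' hfine' hMz W
    (fun _ => hGS W 3) hX hns

end Summit.BirchSwinnertonDyer.Rank1Residual.ClassX11a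

end
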